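import Summits.MatrixMultiplication.MatrixMultiplication.Theorems.FarEdgeDescentGenericAntichain
import HarnessLib

/-!
# The 24 star tensors `𝔖_φ` (`n = 2`, `L = 1`) form exactly four degeneration classes

Route `FarEdgeDescent` (cell `decomp-mm`, lens 2 «structural dichotomy (special vs generic)»,
gen 32), Kernel VII — classification; support for the aside `SubLogRate`
(stmt-MatrixMultiplication-25371).

For `φ ∈ S₄ = Perm(2 × 2)` the star `𝔖_φ = permStar K 2 1 φ` (Kernel VI) reads the second product
of `(X, (Y, Y')) ↦ (XY, φ(X)Y')` through the relabeling `φ` of the entries of `X`.  The SPECIAL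
stratum is `φ ∈ V₄ = S₂ × S₂` (product relabelings, `𝔖_φ ≅ ⟨2,2,2⟩`); the GENERIC stratum is its
complement (20 permutations).  Since `V₄ ◁ S₄` with `S₄ / V₄ ≅ S₃`, and since
`𝔖_{φv} ≅ 𝔖_φ ≅ 𝔖_{vφ}` for product `v` (`permStar_mul_prodCongr_iso`,
`permStar_prodCongr_mul_iso`) and `𝔖_{φ⁻¹} ≅ 𝔖_φ` (`permStar_inv_iso`), the isomorphism type of
`𝔖_φ` only depends on the coset `φV₄ ∈ S₃` up to inversion: the identity (special class), the
three involutions `ᵀ = prodComm`, `T_rd`, `T_cd`, and the pair of 3-cycles `C₃^{±1}`.  Kernel VII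
identified `𝔖_{T_rd} ≅ 𝔖_{T_cd} ≅ 𝔖^♭` and `𝔖_{C₃} ≅ 𝔖^♭ᵀ` (characteristic `≠ 2`,
`FarEdgeDescentSignTwist`), and `FarEdgeDescentGenericAntichain` shows that
`⟨2,2,2⟩, 𝔖^ᵀ, 𝔖^♭, 𝔖^♭ᵀ` are pairwise degeneration-incomparable.  Hence
(`permStar_degeneratesTo_iff`, infinite field of characteristic `≠ 2`):

  **`𝔖_φ ⊵ 𝔖_ψ ⇔ 𝔖_φ ≥ 𝔖_ψ ⇔ 𝔖_φ ≅ 𝔖_ψ ⇔ cls φ = cls ψ`**, with exactly four classes of sizes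
  `4 (special ≅ ⟨2,2,2⟩), 4 (≅ 𝔖^ᵀ), 8 (≅ 𝔖^♭), 8 (≅ 𝔖^♭ᵀ)` (`cls_card`).

The degeneration order on the whole family is EQUALITY of classes: a four-element antichain of
quantum twins (`FarEdgeDescentTwistQuantumTwin`).  This is the complete form of lens 2's
special/generic dichotomy at `n = 2`, `L = 1`, `N = 1`.

References: P. Bürgisser, M. Clausen, M. A. Shokrollahi, *Algebraic Complexity Theory* (1997),
(15.19), §20.2 [BurgisserClausenShokrollahi1997]; H. Cohn, C. Umans, SODA 2013, §3
[CohnUmans2013]; M. Bläser, M. Christandl, J. Zuiddam, arXiv:1705.09652, Thm. 1–2, Def. 5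
[BlaserChristandlZuiddam2017].
-/

noncomputable section

open scoped BigOperators

set_option linter.dupNamespace false

namespace Summit.MatrixMultiplication.MatrixMultiplication.Theorems.FarEdgeDescentPermStarClasses

open Literature.Computability.AlgebraicComplexity
open Summit.MatrixMultiplication.MatrixMultiplication.Theorems.FarEdgeDescentTwistedStar
open Summit.MatrixMultiplication.MatrixMultiplication.Theorems.FarEdgeDescentTwistRigidity
open Summit.MatrixMultiplication.MatrixMultiplication.Theorems.FarEdgeDescentSignTwist
open Summit.MatrixMultiplication.MatrixMultiplication.Theorems.FarEdgeDescentSignTwistDet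
open Summit.MatrixMultiplication.MatrixMultiplication.Theorems.FarEdgeDescentGenericAntichain

universe u

/-! ## Mutual restriction -/

section IsoDefs
variable {K : Type u} [Field K] {ι κ μ ι' κ' μ' ι'' κ'' μ'' : Type*}
  [Fintype ι] [Fintype κ] [Fintype μ] [Fintype ι'] [Fintype κ'] [Fintype μ']
  [Fintype ι''] [Fintype κ''] [Fintype μ'']

/-- **Mutual restriction** `s ≥ t ∧ t ≥ s` (isomorphism, for concise tensors of equal format).
[cite: BurgisserClausenShokrollahi1997, (14.26)] -/
def TensorIso (s : ι → κ → μ → K) (t : ι' → κ' → μ' → K) : Prop :=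
  TensorRestrictsTo s t ∧ TensorRestrictsTo t s

/-- Symmetry. [folklore] -/
theorem TensorIso.symm {s : ι → κ → μ → K} {t : ι' → κ' → μ' → K} (h : TensorIso s t) :
    TensorIso t s := ⟨h.2, h.1⟩

/-- Transitivity. [folklore] -/
theorem TensorIso.trans {s : ι → κ → μ → K} {t : ι' → κ' → μ' → K} {p : ι'' → κ'' → μ'' → K}
    (h : TensorIso s t) (h' : TensorIso t p) : TensorIso s p :=
  ⟨h.1.trans h'.1, h'.2.trans h.2⟩

/-- Degeneration is transported along mutual restrictions.
[cite: BurgisserClausenShokrollahi1997, (15.25)] -/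
theorem TensorIso.algDegeneratesTo_iff {s : ι → κ → μ → K} {s' : ι' → κ' → μ' → K}
    {t : ι → κ'' → μ → K} {t' : ι' → κ' → μ' → K} (hs : TensorIso s s') (ht : TensorIso t t') :
    AlgDegeneratesTo s t ↔ AlgDegeneratesTo s' t' :=
  ⟨fun h => hs.2.algDegeneratesTo_trans (h.trans_restrictsTo ht.1),
    fun h => hs.1.algDegeneratesTo_trans (h.trans_restrictsTo ht.2)⟩

end IsoDefs

/-! ## Relabeling isomorphisms of `𝔖_φ` (general `n`, `L`) -/

section Relabel
variable (K : Type u) [Field K] {n L : ℕ}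

/-- Relabel the rows of the `inl` leaves. [folklore] -/
def relabInl (ρ : Fin n → Fin n) :
    (Fin n × Fin L) ⊕ (Fin n × Fin L) → (Fin n × Fin L) ⊕ (Fin n × Fin L) :=
  Sum.map (fun a => (ρ a.1, a.2)) id

/-- Relabel the rows of the `inr` leaves. [folklore] -/
def relabInr (ρ : Fin n → Fin n) :
    (Fin n × Fin L) ⊕ (Fin n × Fin L) → (Fin n × Fin L) ⊕ (Fin n × Fin L) :=
  Sum.map id (fun a => (ρ a.1, a.2))

/-- `𝔖_{φ (σ×τ)}` is `𝔖_φ` relabelled (`x` through `σ × τ`, `inl` leaves through `σ`, `τ`).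
[folklore] -/
theorem permStar_precomp_prodCongr (φ : Equiv.Perm (Fin n × Fin n)) (σ τ : Equiv.Perm (Fin n)) :
    (fun a b c => permStar K n L φ (relabInl σ a) (Equiv.prodCongr σ τ b) (relabInl τ c)) =
      permStar K n L (φ * Equiv.prodCongr σ τ) := by
  funext a b c
  obtain ⟨b₁, b₂⟩ := b
  rcases a with ⟨i, l⟩ | ⟨i, l⟩ <;> rcases c with ⟨j, l'⟩ | ⟨j, l'⟩ <;>
    simp [relabInl, matMulTensor, Equiv.Perm.mul_apply]

/-- `𝔖_{(σ×τ) φ}` is `𝔖_φ` relabelled (`inr` leaves through `σ⁻¹`, `τ⁻¹`). [folklore] -/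
theorem permStar_precomp_prodCongr_left (φ : Equiv.Perm (Fin n × Fin n))
    (σ τ : Equiv.Perm (Fin n)) :
    (fun a b c => permStar K n L φ (relabInr σ.symm a) b (relabInr τ.symm c)) =
      permStar K n L (Equiv.prodCongr σ τ * φ) := by
  funext a b c
  rcases a with ⟨i, l⟩ | ⟨i, l⟩ <;> rcases c with ⟨j, l'⟩ | ⟨j, l'⟩ <;>
    simp [relabInr, matMulTensor, Equiv.Perm.mul_apply, Equiv.symm_apply_eq,
      Equiv.eq_symm_apply]

/-- `𝔖_{φ⁻¹}` is `𝔖_φ` relabelled (`x` through `φ⁻¹`, the two leaf blocks swapped). [folklore] -/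
theorem permStar_precomp_inv (φ : Equiv.Perm (Fin n × Fin n)) :
    (fun a b c => permStar K n L φ (Sum.swap a) (φ⁻¹ b) (Sum.swap c)) = permStar K n L φ⁻¹ := by
  funext a b c
  rcases a with a | a <;> rcases c with c | c <;> simp

/-- **`𝔖_{φ(σ×τ)} ≅ 𝔖_φ`.** [folklore] -/
theorem permStar_mul_prodCongr_iso (φ : Equiv.Perm (Fin n × Fin n)) (σ τ : Equiv.Perm (Fin n)) :
    TensorIso (permStar K n L (φ * Equiv.prodCongr σ τ)) (permStar K n L φ) := by
  have h1 : ∀ (ψ : Equiv.Perm (Fin n × Fin n)) (σ' τ' : Equiv.Perm (Fin n)),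
      TensorRestrictsTo (permStar K n L ψ) (permStar K n L (ψ * Equiv.prodCongr σ' τ')) :=
    fun ψ σ' τ' => by
      rw [← permStar_precomp_prodCongr]; exact tensorRestrictsTo_precomp _ _ _ _
  refine ⟨?_, h1 φ σ τ⟩
  have h := h1 (φ * Equiv.prodCongr σ τ) σ.symm τ.symm
  have e : φ * Equiv.prodCongr σ τ * Equiv.prodCongr σ.symm τ.symm = φ := by
    ext ⟨b₁, b₂⟩ <;> simp [Equiv.Perm.mul_apply]
  rwa [e] at h

/-- **`𝔖_{(σ×τ)φ} ≅ 𝔖_φ`.** [folklore] -/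
theorem permStar_prodCongr_mul_iso (φ : Equiv.Perm (Fin n × Fin n)) (σ τ : Equiv.Perm (Fin n)) :
    TensorIso (permStar K n L (Equiv.prodCongr σ τ * φ)) (permStar K n L φ) := by
  have h1 : ∀ (ψ : Equiv.Perm (Fin n × Fin n)) (σ' τ' : Equiv.Perm (Fin n)),
      TensorRestrictsTo (permStar K n L ψ) (permStar K n L (Equiv.prodCongr σ' τ' * ψ)) :=
    fun ψ σ' τ' => by
      rw [← permStar_precomp_prodCongr_left]; exact tensorRestrictsTo_precomp _ _ _ _
  refine ⟨?_, h1 φ σ τ⟩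
  have h := h1 (Equiv.prodCongr σ τ * φ) σ.symm τ.symm
  have e : Equiv.prodCongr σ.symm τ.symm * (Equiv.prodCongr σ τ * φ) = φ := by
    ext ⟨b₁, b₂⟩ <;> simp [Equiv.Perm.mul_apply]
  rwa [e] at h

/-- **`𝔖_{φ⁻¹} ≅ 𝔖_φ`.** [folklore] -/
theorem permStar_inv_iso (φ : Equiv.Perm (Fin n × Fin n)) :
    TensorIso (permStar K n L φ⁻¹) (permStar K n L φ) := by
  have h1 : ∀ ψ : Equiv.Perm (Fin n × Fin n),
      TensorRestrictsTo (permStar K n L ψ) (permStar K n L ψ⁻¹) := fun ψ => by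
    rw [← permStar_precomp_inv]; exact tensorRestrictsTo_precomp _ _ _ _
  refine ⟨?_, h1 φ⟩
  have h := h1 φ⁻¹
  rwa [inv_inv] at h

/-- **Cosets**: if `ψ φ` is a product relabeling then `𝔖_φ ≅ 𝔖_{ψ⁻¹}`. [folklore] -/
theorem iso_of_isProdPerm_mul {ψ φ : Equiv.Perm (Fin n × Fin n)} (h : IsProdPerm (ψ * φ)) :
    TensorIso (permStar K n L φ) (permStar K n L ψ⁻¹) := by
  obtain ⟨σ, τ, hst⟩ := h
  set eσ := Equiv.ofBijective σ (Finite.injective_iff_bijective.mp (IsProdPerm.injective_fst hst))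
  set eτ := Equiv.ofBijective τ (Finite.injective_iff_bijective.mp (IsProdPerm.injective_snd hst))
  have hv : ψ * φ = Equiv.prodCongr eσ eτ := by
    ext b <;> simp [hst b, eσ, eτ]
  have hφ : φ = ψ⁻¹ * Equiv.prodCongr eσ eτ := by rw [← hv]; group
  rw [hφ]
  exact permStar_mul_prodCongr_iso K ψ⁻¹ eσ eτ

end Relabel

/-! ## The four classes at `n = 2`, `L = 1` -/

section Classes
variable (K : Type u) [Field K]

/-- Product relabelings of `2 × 2` are decidable. [folklore] -/
def decIsProdPerm (φ : Equiv.Perm (Fin 2 × Fin 2)) : Decidable (IsProdPerm φ) := by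
  unfold IsProdPerm; infer_instance

/-- Boolean test for product relabelings of `2 × 2`: rows go to rows and columns to columns.
[folklore] -/
def isProdB (φ : Equiv.Perm (Fin 2 × Fin 2)) : Bool :=
  (φ (0, 0)).1 == (φ (0, 1)).1 && (φ (1, 0)).1 == (φ (1, 1)).1 &&
    (φ (0, 0)).2 == (φ (1, 0)).2 && (φ (0, 1)).2 == (φ (1, 1)).2

/-- `isProdB` decides `IsProdPerm`. [folklore] -/
theorem isProdB_iff : ∀ φ : Equiv.Perm (Fin 2 × Fin 2), isProdB φ = true ↔ IsProdPerm φ := by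
  letI : DecidablePred (@IsProdPerm (Fin 2)) := decIsProdPerm
  decide

/-- **The class of `φ ∈ S₄`**: `0` special (`V₄`), `1` the coset of `ᵀ`, `2` the cosets of
`T_rd, T_cd`, `3` the cosets of `C₃^{±1}`. [folklore] -/
def cls (φ : Equiv.Perm (Fin 2 × Fin 2)) : Fin 4 :=
  if isProdB φ then 0
  else if isProdB (Equiv.prodComm (Fin 2) (Fin 2) * φ) then 1
  else if isProdB (Trd * φ) || isProdB (Tcd * φ) then 2 else 3

/-- `S₄ = V₄ ⊔ ᵀV₄ ⊔ T_rd V₄ ⊔ T_cd V₄ ⊔ C₃⁻¹V₄ ⊔ C₃V₄`, Boolean form. [folklore] -/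
theorem cls_specB : ∀ φ : Equiv.Perm (Fin 2 × Fin 2),
    (cls φ = 0 ∧ isProdB φ = true) ∨
    (cls φ = 1 ∧ isProdB (Equiv.prodComm (Fin 2) (Fin 2) * φ) = true) ∨
    (cls φ = 2 ∧ (isProdB (Trd * φ) = true ∨ isProdB (Tcd * φ) = true)) ∨
    (cls φ = 3 ∧ (isProdB (C3 * φ) = true ∨ isProdB (C3⁻¹ * φ) = true)) := by
  decide

/-- **`S₄ = V₄ ⊔ ᵀV₄ ⊔ T_rd V₄ ⊔ T_cd V₄ ⊔ C₃⁻¹V₄ ⊔ C₃V₄`**, read through `cls`. [folklore] -/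
theorem cls_spec (φ : Equiv.Perm (Fin 2 × Fin 2)) :
    (cls φ = 0 ∧ IsProdPerm φ) ∨ (cls φ = 1 ∧ IsProdPerm (Equiv.prodComm (Fin 2) (Fin 2) * φ)) ∨
    (cls φ = 2 ∧ (IsProdPerm (Trd * φ) ∨ IsProdPerm (Tcd * φ))) ∨
    (cls φ = 3 ∧ (IsProdPerm (C3 * φ) ∨ IsProdPerm (C3⁻¹ * φ))) := by
  simpa only [isProdB_iff] using cls_specB φ

/-- `cls φ = 0` iff `φ` is a product relabeling. [folklore] -/
theorem cls_eq_zero_iff (φ : Equiv.Perm (Fin 2 × Fin 2)) : cls φ = 0 ↔ IsProdPerm φ := by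
  rw [← isProdB_iff]
  revert φ
  decide

/-- **Class sizes `4, 4, 8, 8`.** [folklore] -/
theorem cls_card :
    (Finset.univ.filter fun φ => cls φ = 0).card = 4 ∧
    (Finset.univ.filter fun φ => cls φ = 1).card = 4 ∧
    (Finset.univ.filter fun φ => cls φ = 2).card = 8 ∧
    (Finset.univ.filter fun φ => cls φ = 3).card = 8 := by
  decide

/-- The named representatives have the expected classes. [folklore] -/
theorem cls_reps : cls (Equiv.refl _) = 0 ∧ cls (Equiv.prodComm (Fin 2) (Fin 2)) = 1 ∧
    cls Trd = 2 ∧ cls Tcd = 2 ∧ cls C3 = 3 ∧ cls C3⁻¹ = 3 := by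
  decide

/-- **Representatives**: `𝔖_{id}, 𝔖^ᵀ, 𝔖^♭, 𝔖^♭ᵀ`. [folklore] -/
def rep : Fin 4 → (Leaf2 → (Fin 2 × Fin 2) → Leaf2 → K) :=
  ![permStar K 2 1 (Equiv.refl _), twistedStar K 2 1, signStar K, signTStar K]

/-- **Every `𝔖_φ` is isomorphic to the representative of its class** (characteristic `≠ 2`).
[folklore] -/
theorem permStar_iso_rep (h2 : (2 : K) ≠ 0) (φ : Equiv.Perm (Fin 2 × Fin 2)) :
    TensorIso (permStar K 2 1 φ) (rep K (cls φ)) := by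
  have hT : (Equiv.prodComm (Fin 2) (Fin 2))⁻¹ = Equiv.prodComm (Fin 2) (Fin 2) := by decide
  have hrd : (Trd)⁻¹ = Trd := by decide
  have hcd : (Tcd)⁻¹ = Tcd := by decide
  rcases cls_spec φ with ⟨hc, hp⟩ | ⟨hc, hp⟩ | ⟨hc, hp | hp⟩ | ⟨hc, hp | hp⟩ <;>
    simp only [hc, rep]
  · exact ⟨(permStar_restrictsTo_matMul hp).trans (matMul_restrictsTo_permStar IsProdPerm.refl),
      (permStar_restrictsTo_matMul IsProdPerm.refl).trans (matMul_restrictsTo_permStar hp)⟩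
  · have h := iso_of_isProdPerm_mul K (L := 1) hp
    rwa [hT, permStar_prodComm] at h
  · have h := iso_of_isProdPerm_mul K (L := 1) hp
    rw [hrd] at h
    exact h.trans (signStar_iso_permStar_Trd K h2).symm
  · have h := iso_of_isProdPerm_mul K (L := 1) hp
    rw [hcd] at h
    exact h.trans (signStar_iso_permStar_Tcd K h2).symm
  · exact ((iso_of_isProdPerm_mul K (L := 1) hp).trans (permStar_inv_iso K C3)).trans
      (signTStar_iso_permStar_C3 K h2).symm
  · have h := iso_of_isProdPerm_mul K (L := 1) hp
    rw [inv_inv] at h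
    exact h.trans (signTStar_iso_permStar_C3 K h2).symm

/-- **The four representatives are pairwise degeneration-incomparable** (infinite field,
characteristic `≠ 2`). [cite: BurgisserClausenShokrollahi1997, (15.19), sec. 20.2] -/
theorem rep_antichain [Infinite K] (h2 : (2 : K) ≠ 0) :
    ∀ i j : Fin 4, i ≠ j → ¬ AlgDegeneratesTo (rep K i) (rep K j) := by
  obtain ⟨⟨hMT, hTM⟩, ⟨hMF, hFM⟩, ⟨hMG, hGM⟩, ⟨hTF, hFT⟩, ⟨hTG, hGT⟩, ⟨hFG, hGF⟩⟩ :=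
    generic_stratum_antichain K h2
  have m0 : TensorRestrictsTo (matMulTensor K 2 2 (1 + 1)) (permStar K 2 1 (Equiv.refl _)) :=
    matMul_restrictsTo_permStar IsProdPerm.refl
  have r0 : TensorRestrictsTo (permStar K 2 1 (Equiv.refl _)) (matMulTensor K 2 2 (1 + 1)) :=
    permStar_restrictsTo_matMul IsProdPerm.refl
  have h0T : ¬ AlgDegeneratesTo (permStar K 2 1 (Equiv.refl _)) (twistedStar K 2 1) :=
    fun h => hMT (m0.algDegeneratesTo_trans h)
  have h0F : ¬ AlgDegeneratesTo (permStar K 2 1 (Equiv.refl _)) (signStar K) :=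
    fun h => hMF (m0.algDegeneratesTo_trans h)
  have h0G : ¬ AlgDegeneratesTo (permStar K 2 1 (Equiv.refl _)) (signTStar K) :=
    fun h => hMG (m0.algDegeneratesTo_trans h)
  have hT0 : ¬ AlgDegeneratesTo (twistedStar K 2 1) (permStar K 2 1 (Equiv.refl _)) :=
    fun h => hTM (h.trans_restrictsTo r0)
  have hF0 : ¬ AlgDegeneratesTo (signStar K) (permStar K 2 1 (Equiv.refl _)) :=
    fun h => hFM (h.trans_restrictsTo r0)
  have hG0 : ¬ AlgDegeneratesTo (signTStar K) (permStar K 2 1 (Equiv.refl _)) :=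
    fun h => hGM (h.trans_restrictsTo r0)
  intro i j hij
  fin_cases i <;> fin_cases j
  · exact absurd rfl hij
  · exact h0T
  · exact h0F
  · exact h0G
  · exact hT0
  · exact absurd rfl hij
  · exact hTF
  · exact hTG
  · exact hF0
  · exact hFT
  · exact absurd rfl hij
  · exact hFG
  · exact hG0
  · exact hGT
  · exact hGF
  · exact absurd rfl hij

/-- **Classification of the `n = 2`, `L = 1` stars by degeneration**: `𝔖_φ ⊵ 𝔖_ψ` iff `φ` and
`ψ` have the same class; the degeneration order on `{𝔖_φ : φ ∈ S₄}` is equality of classes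
(infinite field, characteristic `≠ 2`).
[cite: BurgisserClausenShokrollahi1997, (15.19), sec. 20.2] -/
theorem permStar_degeneratesTo_iff [Infinite K] (h2 : (2 : K) ≠ 0)
    (φ ψ : Equiv.Perm (Fin 2 × Fin 2)) :
    AlgDegeneratesTo (permStar K 2 1 φ) (permStar K 2 1 ψ) ↔ cls φ = cls ψ := by
  constructor
  · intro h
    by_contra hne
    exact rep_antichain K h2 _ _ hne
      (((permStar_iso_rep K h2 φ).algDegeneratesTo_iff (permStar_iso_rep K h2 ψ)).mp h)
  · intro h
    have e := permStar_iso_rep K h2 φ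
    rw [h] at e
    exact (e.trans (permStar_iso_rep K h2 ψ).symm).1.algDegeneratesTo

/-- **Restriction version**: `𝔖_φ ≥ 𝔖_ψ` iff same class, iff `𝔖_φ ≅ 𝔖_ψ`.
[cite: BurgisserClausenShokrollahi1997, (14.26)] -/
theorem permStar_restrictsTo_iff [Infinite K] (h2 : (2 : K) ≠ 0)
    (φ ψ : Equiv.Perm (Fin 2 × Fin 2)) :
    TensorRestrictsTo (permStar K 2 1 φ) (permStar K 2 1 ψ) ↔ cls φ = cls ψ := by
  refine ⟨fun h => (permStar_degeneratesTo_iff K h2 φ ψ).mp h.algDegeneratesTo, fun h => ?_⟩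
  have e := permStar_iso_rep K h2 φ
  rw [h] at e
  exact (e.trans (permStar_iso_rep K h2 ψ).symm).1

/-- **The special/generic dichotomy, complete form** (`n = 2`, `L = 1`): `𝔖_φ` degenerates to
(equivalently: from) `⟨2,2,2⟩` iff `φ` is a product relabeling, and the generic stratum splits
into exactly three further classes `≅ 𝔖^ᵀ, 𝔖^♭, 𝔖^♭ᵀ`, pairwise incomparable with each other
and with `⟨2,2,2⟩`. [cite: BurgisserClausenShokrollahi1997, (15.19), sec. 20.2] -/
theorem special_generic_dichotomy [Infinite K] (h2 : (2 : K) ≠ 0)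
    (φ : Equiv.Perm (Fin 2 × Fin 2)) :
    (AlgDegeneratesTo (permStar K 2 1 φ) (matMulTensor K 2 2 (1 + 1)) ↔ IsProdPerm φ) ∧
    (AlgDegeneratesTo (matMulTensor K 2 2 (1 + 1)) (permStar K 2 1 φ) ↔ IsProdPerm φ) ∧
    (¬ IsProdPerm φ → TensorIso (permStar K 2 1 φ) (twistedStar K 2 1) ∨
      TensorIso (permStar K 2 1 φ) (signStar K) ∨ TensorIso (permStar K 2 1 φ) (signTStar K)) := by
  have hiff := cls_eq_zero_iff
  have e0 : TensorIso (permStar K 2 1 (Equiv.refl _)) (matMulTensor K 2 2 (1 + 1)) :=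
    ⟨permStar_restrictsTo_matMul IsProdPerm.refl, matMul_restrictsTo_permStar IsProdPerm.refl⟩
  refine ⟨?_, ?_, fun hφ => ?_⟩
  · rw [← hiff, ← cls_reps.1, ← permStar_degeneratesTo_iff K h2]
    exact ⟨fun h => h.trans_restrictsTo e0.2, fun h => h.trans_restrictsTo e0.1⟩
  · rw [← hiff, eq_comm, ← cls_reps.1, ← permStar_degeneratesTo_iff K h2]
    exact ⟨fun h => e0.1.algDegeneratesTo_trans h, fun h => e0.2.algDegeneratesTo_trans h⟩
  · have e := permStar_iso_rep K h2 φ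
    rcases cls_spec φ with ⟨hc, hp⟩ | ⟨hc, -⟩ | ⟨hc, -⟩ | ⟨hc, -⟩
    · exact absurd hp hφ
    · left; simpa [hc, rep] using e
    · right; left; simpa [hc, rep] using e
    · right; right; simpa [hc, rep] using e

end Classes

end Summit.MatrixMultiplication.MatrixMultiplication.Theorems.FarEdgeDescentPermStarClasses

end
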